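import Literature.Claims.NS.ClayVariants
import Literature.Claims.NS.Rockwell2025
import Literature.Analysis.ODE.GlobalFlowBoundedLipschitzField
import Literature.Claims.NS.ClayPeriodicBlowupAlternative
import Literature.Analysis.FluidPDE.TorusNSBealeKatoMajda
import Literature.Barriers.NavierStokesRegularity.InstantaneousTypeIBlowupDecomposition
import HarnessLib

/-!
# Claim skeleton C153 — C. Betts, «Global Regularity of 3D Incompressible Navier–Stokes» via a
# Lagrangian logarithmic-strain entropy (Zenodo 21941530, concept 18501609, 2026-08-15; 27 pp.)

D-0090 NS-CLAIMS SWEEP, typist = ns-claims-typist-6 g5. TEXT OF RECORD: Zenodo record 21941530, file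
«NavierStokes.pdf» (sha16 6f7414d625638b4d, 27 pp.; PDF page = file `pages/pNNN.txt` of the census pin
`census/texts/Betts2026/`; LOCATORS.md by ns-claims-lit-2 g5). The file TYPES what is printed; nothing is
asserted. Every `def … : Prop` is a transcription of a printed statement with its locator; `theorem`s are
compositions, unfoldings, or proofs of printed steps that ARE theorems (Thm 5.4, the trace identity).

## Setting (§2–§3, pp.4–7) in tree vocabulary
Periodic problem à la Fefferman (B): velocity `u : ℝ → ℝ³ → ℝ³` and pressure `p`, `ℤ³`-periodic in
`x` (`IsLatticePeriodic`, «𝕋³»), classical unforced solutions `IsClassicalNSSolutionOn S ν 0 u p`,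
datum `u 0 = u₀`. DATA CLASS: Thm 1.1 prints «u₀ ∈ H^s(𝕋³), s > 5/2, divergence-free»; typed is the
SMOOTH periodic sub-case (`IsDatum`: `C^∞`, divergence-free, periodic) — the case Clay (B) needs; the
`H^s` face is WIDER (claim STRONGER than (B) on the data axis) and is recorded, not typed
(TODO(general form): `Torus.MemSobolev s`, `s > 5/2`). Lagrangian objects (§2): a flow map `Φ` of `u`
(`Rockwell2025.IsFlowMap T u Φ`: `Φ 0 = id`, `∂ₜΦ_t(a) = u(t, Φ_t(a))` within `[0,T)`), deformation
gradient `F(a,t) = ∇ₐΦ_t(a)` (`defGrad`), right Cauchy–Green tensor `C = FᵀF` (`cauchyGreen`, as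
`star F * F` in the ring `ℝ³ →L[ℝ] ℝ³`), logarithmic strain `E = log U = ½ log C` (Def 3.1 (24)–(25):
spectral definition — `symLog` below is the spectral logarithm of a symmetric operator through Mathlib's
`LinearMap.IsSymmetric.eigenvectorBasis`; `E = ½ log(U²)` is the printed `log U` for `U = C^{1/2}`),
Frobenius product `A : B = tr(AᵀB)` (`frob`), `|E|² = E : E`, geometric entropy `𝓔(t) = ∫_{𝕋³} |E(a,t)|² da`
(Def 3.6 (31); integral over the period cell as the torus integral of `a ↦ |E(repr a, t)|²`).

## Step list (print order of the load-bearing statements; typist flags are reading aids, not verdicts)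
* `Step_Thm45` — Thm 4.5 (43) p.9 in the Eulerian-frame form (53) p.10 (Remark 4.6 «drop the
  tildes»), WITH the printed remainder bound `|C| ≤ C|E||∇u|` (REF flag (b): an unconstrained `C`
  would make (43) a tautology), along Lagrangian labels; derived in print with «≈» steps ((49), (51))
  [suspicious: at `t = 0`, `E = 0` so the bound forces `C(·,0) = 0`, while `∂ₜE(0) = S(u₀)` ≠ `2S(u₀)`
  unless `S(u₀) = 0` — typist's reading aid, the refuter decides].
* `Step_Thm54` — Thm 5.4 (61)/(64) p.12 «E : [E, Ω] = 0» pointwise for symmetric `E`, skew `Ω`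
  (trace cyclicity) — TRUE, PROVED in-file (`step_Thm54_holds`).
* `Step_L59_72` — display (72) p.13 l.60 «‖S‖_{L²} ≤ C‖∇E‖_{L²}» (inside the proof of Lemma 5.9,
  «Using Calderón–Zygmund estimates (Section 7) and elliptic regularity»), `C` absolute
  [suspicious: at `t = 0`, `E ≡ 0` (since `F(·,0) = I`) while `S(u₀) ≠ 0` for every non-rigid datum].
* `Step_L59` — Lemma 5.9 (70) p.13 as stated («∃ C … for any ε > 0, Cε depends on ‖∇u‖_∞»).
* `Step_Thm512` — Thm 5.12 (78)/(82) p.14 «d𝓔/dt + cν∫|∇E|² ≤ 0, c dimensional» — THE LOAD-BEARING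
  CLAIM; its proof passes from (81) «≤ −(ν/2)∫|∇E|² + C𝓔, C = C(‖∇u‖_∞)» to (82) by «At critical
  scaling, the term C𝓔 can be absorbed or bounded uniformly … if 𝓔 remains bounded … (which follows
  from the dissipation inequality itself), then by Theorem 7.4 ‖∇u‖_∞ is bounded» (p.14 l.63–74)
  [suspicious: circular at l.66–74; and `𝓔(0) = 0` for every flow (`F(·,0) = I`), so (82) forces
  `𝓔 ≡ 0`, i.e. `FᵀF ≡ I` — typed consequences `Step_Cor513`, `Step_Cor514`].
* `Step_Cor513` — Cor 5.13 (83) «𝓔(t) ≤ 𝓔(0) for all t ≥ 0»; `Step_Cor514` — Cor 5.14 (84)/(86).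
* `Step_Thm61_BKM` — Thm 6.1 (87) p.15 (BKM with `‖∇u‖_∞`; TRUE-type classically on 𝕋³) folded with
  the §9 assembly into: finite `∫₀ᵀ‖∇u‖_∞` on every half-open slab of every periodic classical solution
  from the datum ⇒ a global smooth periodic solution (printed-(B), errata reading) [TRUE-type: BKM
  continuation + periodic local existence; tree: `clayPeriodic_regularity_iff_aprioriGradientBound`
  is the sup-form, the integral form is not in the tree — flagged].
* `Step_Thm63` — Thm 6.3 (88) p.15 (= Cor 7.8 p.18) «‖∇u(t)‖_∞ ≤ C(‖E(t)‖_{L²} + ‖∇E(t)‖_{L²}), C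
  dimensional» [suspicious: at `t = 0` the right side vanishes for every flow].
* `Step_Prop65` — Prop 6.5 p.16, typed at the grain of its concluding display (96): every smooth
  periodic solution on `[0,T)` from the datum has `∫₀ᵀ‖∇u‖_∞ dt < ∞`.
* `Step_Thm79` — Thm 7.9 p.19 (i) ⇒ (ii) (the direction used), recorded; §8 (weak solutions) is an
  additional claim, not on the path to Thm 1.1, not typed.
* COMPOSITION (PROVED): `prop65_of_steps : Step_Thm63 → Step_Cor513 → Step_Cor514 → Step_Prop65`
  (the arithmetic (91)–(96) p.16, with `√x ≤ 1 + x` in place of the print's (94), which confuses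
  `∫‖∇E‖_{L²}` with `∫‖∇E‖²_{L²}` — immaterial for finiteness) and
  `claim_of_steps : Step_FlowMap → Step_Thm63 → Step_Cor513 → Step_Cor514 → Step_Thm61_BKM → ClaimedTheorem`;
  `clayB_of_claimed : ClaimedTheorem → clayPeriodic.Regularity` PROVED (errata-(B) ⇒ printed (B)).

## References
* [Betts2026] C. Betts, Zenodo 21941530 (2026), 27 pp.
* [FeffermanClay2006] C. L. Fefferman, CMI problem description, (B) with (8)–(11).
* [BealeKatoMajda1984] Beale–Kato–Majda, Comm. Math. Phys. 94 (1984), Thm 1.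

WHAT THIS IS NOT: not a claim about NS regularity or blow-up; not a claim about any author beyond
the typed locator.
-/

open scoped ContDiff ENNReal NNReal Topology InnerProductSpace Laplacian
open Set MeasureTheory Filter

namespace Literature.Claims.NS.Betts2026

open Literature.Analysis Literature.Analysis.FluidPDE Literature.Claims.NS.ClayVariants
open Literature.Analysis.FunctionSpaces (Torus.repr)
open Literature.Claims.NS.Rockwell2025 (IsFlowMap)

noncomputable section

/-- `ℝ³` (the text's `𝕋³ = ℝ³/ℤ³` is realised by `ℤ³`-periodic fields on `ℝ³`, Fefferman (8)). [folklore] [cite: FeffermanClay2006, (8) p.2] -/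
abbrev E3 := EuclideanSpace ℝ (Fin 3)

/-- `3 × 3` real matrices as operators on `ℝ³` (the text's `F`, `U`, `E`, `S`, `Ω`; §2 p.4). [folklore] [cite: Betts2026, §2 (12)–(18) p.4] -/
abbrev Op := E3 →L[ℝ] E3

/-! ## Setting: data, periodic solutions, Lagrangian objects (§2–§3) -/

/-- ADMISSIBLE DATUM, smooth sub-case of Thm 1.1 p.3 l.14–17 («u₀ ∈ H^s(𝕋³), s > 5/2, divergence-free»):
`C^∞`, divergence-free, `ℤ³`-periodic. The printed class `H^s`, `s > 5/2` is WIDER (recorded in the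
module docstring; TODO(general form): `Torus.MemSobolev s`). [cite: Betts2026, Thm 1.1 p.3 l.14–18] -/
structure IsDatum (u₀ : E3 → E3) : Prop where
  smooth : ContDiff ℝ ∞ u₀
  divFree : NSWave0.IsDivFree u₀
  periodic : IsLatticePeriodic u₀

/-- «a smooth solution of the 3D incompressible Navier–Stokes equations on 𝕋³» on the time set `S`
from `u₀` (Thm 5.12 p.14 l.3–6; Prop 6.5 p.16 l.3–4): classical, unforced, `u 0 = u₀`, `u(·,t)` and
`p(·,t)` periodic (CMI errata reading of (10)). [cite: Betts2026, Thm 5.12 p.14 l.3–6; Prop 6.5 p.16 l.3–5] [cite: FeffermanClay2006, (10)–(11) p.2] -/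
structure IsSolutionOn (S : Set ℝ) (ν : ℝ) (u₀ : E3 → E3) (u : ℝ → E3 → E3) (p : ℝ → E3 → ℝ) :
    Prop where
  solves : IsClassicalNSSolutionOn S ν 0 u p
  initial : u 0 = u₀
  periodic : ∀ t ∈ S, IsLatticePeriodic (u t) ∧ IsLatticePeriodic (p t)

/-- The deformation gradient `F(a,t) = ∇ₐΦ_t(a)` of a flow map `Φ` ((12) p.4). [cite: Betts2026, (12)–(13) p.4] -/
def defGrad (Φ : ℝ → E3 → E3) (t : ℝ) (a : E3) : Op := fderiv ℝ (Φ t) a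

/-- The right Cauchy–Green tensor `C = FᵀF` (§4.1 p.8), as `star F * F` in the operator ring (`star` =
adjoint = transpose on `ℝ³`). [cite: Betts2026, Prop 4.1 p.8 l.61] -/
def cauchyGreen (F : Op) : Op := star F * F

/-- `C = FᵀF` is symmetric (Prop 4.1 p.8: «C = FᵀF … symmetric positive-definite»). [cite: Betts2026, §4.1 p.8 l.58–66] -/
theorem isSymmetric_cauchyGreen (F : Op) : ((cauchyGreen F : Op) : E3 →ₗ[ℝ] E3).IsSymmetric :=
  ContinuousLinearMap.isSelfAdjoint_iff_isSymmetric.1 (IsSelfAdjoint.star_mul_self F)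

/-- The SPECTRAL LOGARITHM of a symmetric operator `A` on `ℝ³` (Def 3.1 (25) p.6: «if U = Q diag(λ₁,λ₂,λ₃)Qᵀ
then log U = Q diag(log λ₁, log λ₂, log λ₃)Qᵀ»): `x ↦ Σᵢ log(λᵢ) ⟪bᵢ, x⟫ bᵢ` for Mathlib's orthonormal
eigenbasis `b` with eigenvalues `λ` of `A` (junk `Real.log` values where `λᵢ ≤ 0`; only positive-definite
arguments occur below). [cite: Betts2026, Def 3.1 (24)–(25) p.6] -/
def symLog (A : Op) (hA : (A : E3 →ₗ[ℝ] E3).IsSymmetric) : Op :=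
  ∑ i, Real.log (hA.eigenvalues finrank_euclideanSpace_fin i) •
    (innerSL ℝ (hA.eigenvectorBasis finrank_euclideanSpace_fin i)).smulRight
      (hA.eigenvectorBasis finrank_euclideanSpace_fin i)

/-- The LOGARITHMIC STRAIN of a deformation gradient, `E = log U = ½ log C`, `C = FᵀF = U²` (Def 3.1
(24) p.6 with the polar decomposition `F = RU`, Thm 2.5 p.5). [cite: Betts2026, Def 3.1 (24)–(25) p.6; Thm 2.5 p.5] -/
def logStrain (F : Op) : Op := (1 / 2 : ℝ) • symLog (cauchyGreen F) (isSymmetric_cauchyGreen F)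

/-- The Frobenius product `A : B = tr(AᵀB)` (Thm 5.4 proof p.12 l.26). [cite: Betts2026, Thm 5.4 p.12 l.26] -/
def frob (A B : Op) : ℝ := LinearMap.trace ℝ E3 ((star A * B : Op) : E3 →ₗ[ℝ] E3)

/-- `|E|² = E : E = tr(EᵀE)` (Def 3.6 p.7 l.45–47). [cite: Betts2026, Def 3.6 (31) p.7] -/
def frobSq (A : Op) : ℝ := frob A A

/-- The commutator `[E, Ω] = EΩ − ΩE` ((46) p.9). [cite: Betts2026, (46) p.9] -/
def comm (A B : Op) : Op := A * B - B * A

/-- The strain-rate `S = ½(∇u + ∇uᵀ)` and rotation `Ω = ½(∇u − ∇uᵀ)` of a velocity slice ((33) p.8).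
[cite: Betts2026, (33) p.8] -/
def strainOp (v : E3 → E3) (x : E3) : Op := (1 / 2 : ℝ) • (fderiv ℝ v x + star (fderiv ℝ v x))

/-- The rotation tensor `Ω = ½(∇u − ∇uᵀ)` ((33) p.8). [cite: Betts2026, (33) p.8] -/
def rotOp (v : E3 → E3) (x : E3) : Op := (1 / 2 : ℝ) • (fderiv ℝ v x - star (fderiv ℝ v x))

/-- The integral over `𝕋³` of a `ℤ³`-periodic density, as the integral over the flat torus of its
values at the cell representatives (Def 3.6 «∫_{𝕋³} … da»). [cite: Betts2026, Def 3.6 (31) p.7] -/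
def torusIntegral (f : E3 → ℝ) : ℝ := ∫ a : UnitAddTorus (Fin 3), f (Torus.repr a)

/-- GEOMETRIC ENTROPY `𝓔(t) = ∫_{𝕋³} |E(a,t)|² da` of a flow map (Def 3.6 (31) p.7; (77) p.14).
[cite: Betts2026, Def 3.6 (31) p.7; (77) p.14] -/
def entropy (Φ : ℝ → E3 → E3) (t : ℝ) : ℝ := torusIntegral fun a => frobSq (logStrain (defGrad Φ t a))

/-- `‖E(t)‖_{L²}` and `‖∇E(t)‖_{L²}` (§5–§6: (70), (84), (88)): the `L²(𝕋³)` norms of the logarithmic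
strain and of its label-gradient at time `t`. [cite: Betts2026, (70) p.13; (84) p.15; (88) p.15] -/
def normE (Φ : ℝ → E3 → E3) (t : ℝ) : ℝ := Real.sqrt (entropy Φ t)

/-- `‖∇E(t)‖²_{L²} = ∫_{𝕋³} |∇ₐE(a,t)|² da` (operator norm of the label-derivative of `a ↦ E(a,t)`).
[cite: Betts2026, (66) p.12; (78) p.14] -/
def gradESq (Φ : ℝ → E3 → E3) (t : ℝ) : ℝ :=
  torusIntegral fun a => ‖fderiv ℝ (fun b => logStrain (defGrad Φ t b)) a‖ ^ 2

/-- `‖S(t)‖²_{L²(𝕋³)}` ((71)–(72) p.13). [cite: Betts2026, (71)–(72) p.13] -/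
def strainSq (u : ℝ → E3 → E3) (t : ℝ) : ℝ := torusIntegral fun x => ‖strainOp (u t) x‖ ^ 2

/-! ## The claimed statement (Thm 1.1 p.3) and the Clay link -/

/-- **CLAIMED THEOREM (Thm 1.1, p.3 l.14–18), smooth-data sub-case**: «Let u₀ ∈ H^s(𝕋³), s > 5/2, be
divergence-free initial data. Then the corresponding solution of the incompressible Navier–Stokes
equations exists globally in time and remains smooth for all t > 0» — for every `ν > 0` (implicit) and
every smooth divergence-free periodic datum there is a global smooth solution with `u`, `p` periodic
(`clayPeriodicErrata.Solvable ν 0 u₀`). [cite: Betts2026, Thm 1.1 p.3 l.14–18] [claim: Betts2026, status: under-review] -/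
def ClaimedTheorem : Prop :=
  ∀ ν : ℝ, 0 < ν → ∀ u₀ : E3 → E3, IsDatum u₀ → clayPeriodicErrata.Solvable ν 0 u₀

/-- **Clay link (PROVED)**: the claimed theorem (smooth sub-case, errata reading) implies Clay (B) as
printed (`clayPeriodicErrata_regularity_imp_printed`). The printed data class `H^s`, `s > 5/2` is wider,
so the printed claim is STRONGER than (B) on the data axis. [cite: Betts2026, Thm 1.1 p.3] [cite: FeffermanClay2006, (B) p.2] -/
theorem clayB_of_claimed (h : ClaimedTheorem) : clayPeriodic.Regularity :=
  clayPeriodicErrata_regularity_imp_printed fun ν hν u₀ hu₀ hdiv hper => h ν hν u₀ ⟨hu₀, hdiv, hper⟩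

/-! ## Steps -/

/-- **Flow map (§2, (12)–(14) p.4; Prop 2.3 p.5 «Flow map well-posedness»)**: every smooth periodic
solution on `[0,T)` has a flow map on the slab (classical for smooth bounded velocities; periodic smooth
slices are bounded). [cite: Betts2026, (12)–(14) p.4; Prop 2.3 p.5] [claim: Betts2026, status: under-review] -/
def Step_FlowMap : Prop :=
  ∀ ν : ℝ, 0 < ν → ∀ u₀ : E3 → E3, IsDatum u₀ → ∀ (T : ℝ) (u : ℝ → E3 → E3) (p : ℝ → E3 → ℝ),
    0 < T → IsSolutionOn (Ico 0 T) ν u₀ u p → ∃ Φ : ℝ → E3 → E3, IsFlowMap T u Φ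

/-- **Thm 4.5 — «exact evolution equation for the logarithmic strain»**, in the Eulerian-frame form
(53) p.10 (Remark 4.6 «drop the tildes»: «∂E/∂t + u·∇E = 2S + [E, Ω] + ν∆E + C») WITH the printed
remainder bound «C(E, ∇u) represents explicit lower-order commutators satisfying |C| ≤ C|E||∇u|» ((43)
p.9 l.79), read along Lagrangian labels `a` (the material derivative `∂ₜ + u·∇` of the Lagrangian field
`E(a,t)` is its label-wise time derivative; `S`, `Ω`, `∇u` at the particle position `Φ_t(a)`; `∆` in
the label). The derivation (47)–(52) p.10 proceeds by «≈» ((49), (51)); typed as stated.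
[cite: Betts2026, Thm 4.5 (43)–(46) p.9 l.68–79; (53) p.10 l.58–62] [claim: Betts2026, status: under-review] -/
def Step_Thm45 : Prop :=
  ∃ C₀ : ℝ, ∀ ν : ℝ, 0 < ν → ∀ u₀ : E3 → E3, IsDatum u₀ →
    ∀ (T : ℝ) (u : ℝ → E3 → E3) (p : ℝ → E3 → ℝ) (Φ : ℝ → E3 → E3), 0 < T →
      IsSolutionOn (Ico 0 T) ν u₀ u p → IsFlowMap T u Φ →
        ∃ 𝒞 : ℝ → E3 → Op,
          (∀ t ∈ Ico 0 T, ∀ a : E3,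
            ‖𝒞 t a‖ ≤ C₀ * ‖logStrain (defGrad Φ t a)‖ * ‖fderiv ℝ (u t) (Φ t a)‖) ∧
          ∀ t ∈ Ioo 0 T, ∀ a : E3,
            deriv (fun s => logStrain (defGrad Φ s a)) t =
              (2 : ℝ) • strainOp (u t) (Φ t a) +
                comm (logStrain (defGrad Φ t a)) (rotOp (u t) (Φ t a)) +
                ν • (Δ (fun b => logStrain (defGrad Φ t b))) a + 𝒞 t a

/-- **Thm 5.4 (61)/(64) p.12 — «Lie-algebraic cancellation of vortex stretching»**: for symmetric `E`
and skew-symmetric `Ω`, `E : [E, Ω] = 0` pointwise (hence its integral vanishes). TRUE by trace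
cyclicity — PROVED below. [cite: Betts2026, Thm 5.4 (61)–(65) p.12] -/
def Step_Thm54 : Prop :=
  ∀ E Ω : Op, star E = E → star Ω = -Ω → frob E (comm E Ω) = 0

/-- **Display (72) p.13 l.58–60** (proof of Lemma 5.9: «The strain-rate S is related to E through the
velocity gradient. Using Calderón–Zygmund estimates (Section 7) and elliptic regularity:
‖S‖_{L²} ≤ C‖∇E‖_{L²}»), `C` absolute, for every smooth periodic solution, its flow map, and every time
of the slab. [cite: Betts2026, (72) p.13 l.58–60] [claim: Betts2026, status: under-review] -/
def Step_L59_72 : Prop :=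
  ∃ C : ℝ, ∀ ν : ℝ, 0 < ν → ∀ u₀ : E3 → E3, IsDatum u₀ →
    ∀ (T : ℝ) (u : ℝ → E3 → E3) (p : ℝ → E3 → ℝ) (Φ : ℝ → E3 → E3), 0 < T →
      IsSolutionOn (Ico 0 T) ν u₀ u p → IsFlowMap T u Φ →
        ∀ t ∈ Ico 0 T, Real.sqrt (strainSq u t) ≤ C * Real.sqrt (gradESq Φ t)

/-- **Lemma 5.9 (70) p.13 l.31–43** as stated: «There exists a constant C > 0 such that
∫ E : S da ≤ ε∫|∇E|² da + Cε∫|E|² da for any ε > 0, where Cε depends on ‖∇u‖_{L^∞}» — typed with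
`Cε` allowed to depend on `ε` and on the slice's gradient sup `M`. [cite: Betts2026, Lemma 5.9 (70) p.13 l.31–43] [claim: Betts2026, status: under-review] -/
def Step_L59 : Prop :=
  ∀ ε : ℝ, 0 < ε → ∀ M : ℝ, ∃ Cε : ℝ, ∀ ν : ℝ, 0 < ν → ∀ u₀ : E3 → E3, IsDatum u₀ →
    ∀ (T : ℝ) (u : ℝ → E3 → E3) (p : ℝ → E3 → ℝ) (Φ : ℝ → E3 → E3), 0 < T →
      IsSolutionOn (Ico 0 T) ν u₀ u p → IsFlowMap T u Φ →
        ∀ t ∈ Ico 0 T, (∀ x, ‖fderiv ℝ (u t) x‖ ≤ M) →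
          torusIntegral (fun a => frob (logStrain (defGrad Φ t a)) (strainOp (u t) (Φ t a))) ≤
            ε * gradESq Φ t + Cε * entropy Φ t

/-- **Thm 5.12 (78)/(82) p.14 — «Curvature entropy dissipation» (THE LOAD-BEARING CLAIM)**: «there
exists a constant c > 0 depending only on dimension such that d𝓔/dt + cν∫|∇E|² da ≤ 0 for all t for
which the solution is smooth», typed with the derivative as `deriv` of `t ↦ 𝓔(t)` within the slab's
interior. [cite: Betts2026, Thm 5.12 (77)–(78) p.14 l.3–18; (82) p.14 l.75–79] [claim: Betts2026, status: under-review] -/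
def Step_Thm512 : Prop :=
  ∃ c : ℝ, 0 < c ∧ ∀ ν : ℝ, 0 < ν → ∀ u₀ : E3 → E3, IsDatum u₀ →
    ∀ (T : ℝ) (u : ℝ → E3 → E3) (p : ℝ → E3 → ℝ) (Φ : ℝ → E3 → E3), 0 < T →
      IsSolutionOn (Ico 0 T) ν u₀ u p → IsFlowMap T u Φ →
        ∀ t ∈ Ioo 0 T, deriv (entropy Φ) t + c * ν * gradESq Φ t ≤ 0

/-- **Cor 5.13 (83) p.14 — «Entropy monotonicity: 𝓔(t) ≤ 𝓔(0) for all t ≥ 0»** (within the slab).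
[cite: Betts2026, Cor 5.13 (83) p.14 l.81–82] [claim: Betts2026, status: under-review] -/
def Step_Cor513 : Prop :=
  ∀ ν : ℝ, 0 < ν → ∀ u₀ : E3 → E3, IsDatum u₀ →
    ∀ (T : ℝ) (u : ℝ → E3 → E3) (p : ℝ → E3 → ℝ) (Φ : ℝ → E3 → E3), 0 < T →
      IsSolutionOn (Ico 0 T) ν u₀ u p → IsFlowMap T u Φ →
        ∀ t ∈ Ico 0 T, entropy Φ t ≤ entropy Φ 0

/-- **Cor 5.14 (84)/(86) p.15 — «Global curvature gradient control: ∫₀^∞∫|∇E|² da dt ≤ C𝓔(0)»**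
(on the slab: `∫₀ᵀ ‖∇E‖²_{L²} ≤ C·𝓔(0)`, lower integral in `t`, `C = 1/(cν)` allowed to depend on `ν`).
[cite: Betts2026, Cor 5.14 (84)–(86) p.15 l.1–22] [claim: Betts2026, status: under-review] -/
def Step_Cor514 : Prop :=
  ∀ ν : ℝ, 0 < ν → ∃ C : ℝ≥0, ∀ u₀ : E3 → E3, IsDatum u₀ →
    ∀ (T : ℝ) (u : ℝ → E3 → E3) (p : ℝ → E3 → ℝ) (Φ : ℝ → E3 → E3), 0 < T →
      IsSolutionOn (Ico 0 T) ν u₀ u p → IsFlowMap T u Φ →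
        (∫⁻ t in Ioo 0 T, ENNReal.ofReal (gradESq Φ t)) ≤ C * ENNReal.ofReal (entropy Φ 0)

/-- **Thm 6.3 (88) p.15 (= Cor 7.8 (109) p.18) — «Geometric-to-Eulerian equivalence:
‖∇u(t)‖_{L^∞} ≤ C(‖E(t)‖_{L²} + ‖∇E(t)‖_{L²}) for some constant C depending only on dimension»**.
[cite: Betts2026, Thm 6.3 (88) p.15 l.43–46; Cor 7.8 p.18] [claim: Betts2026, status: under-review] -/
def Step_Thm63 : Prop :=
  ∃ C : ℝ≥0, ∀ ν : ℝ, 0 < ν → ∀ u₀ : E3 → E3, IsDatum u₀ →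
    ∀ (T : ℝ) (u : ℝ → E3 → E3) (p : ℝ → E3 → ℝ) (Φ : ℝ → E3 → E3), 0 < T →
      IsSolutionOn (Ico 0 T) ν u₀ u p → IsFlowMap T u Φ →
        ∀ t ∈ Ico 0 T, (⨆ x : E3, ‖fderiv ℝ (u t) x‖ₑ) ≤
          C * (ENNReal.ofReal (normE Φ t) + ENNReal.ofReal (Real.sqrt (gradESq Φ t)))

/-- **Prop 6.5 p.16 («Blow-up obstruction»), at the grain of its concluding display (96)**: for every
smooth periodic solution on `[0,T)` from an admissible datum, `∫₀ᵀ ‖∇u‖_{L^∞} dt < ∞` (with a flow map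
on the slab, Step_FlowMap). [cite: Betts2026, Prop 6.5 (89)–(96) p.16 l.3–45] [claim: Betts2026, status: under-review] -/
def Step_Prop65 : Prop :=
  ∀ ν : ℝ, 0 < ν → ∀ u₀ : E3 → E3, IsDatum u₀ →
    ∀ (T : ℝ) (u : ℝ → E3 → E3) (p : ℝ → E3 → ℝ) (Φ : ℝ → E3 → E3), 0 < T →
      IsSolutionOn (Ico 0 T) ν u₀ u p → IsFlowMap T u Φ →
        (∫⁻ t in Ioo 0 T, ⨆ x : E3, ‖fderiv ℝ (u t) x‖ₑ) < ⊤

/-- **Thm 6.1 (87) p.15 (Beale–Kato–Majda, gradient form) with the §9 assembly p.21–23**: if every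
smooth periodic solution on every half-open slab `[0,T)` from the datum has
`∫₀ᵀ‖∇u‖_∞ < ∞`, then the datum launches a GLOBAL smooth periodic solution (continuation + periodic
local existence). TRUE-type classically; not in the tree in this integral form (the tree's periodic
alternative is the gradient-SUP form `clayPeriodic_regularity_iff_aprioriGradientBound`). [cite: Betts2026, Thm 6.1 (87) p.15 l.30–35; §9 p.21–23] [cite: BealeKatoMajda1984, Thm 1] [claim: Betts2026, status: under-review] -/
def Step_Thm61_BKM : Prop :=
  ∀ ν : ℝ, 0 < ν → ∀ u₀ : E3 → E3, IsDatum u₀ →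
    (∀ (T : ℝ) (u : ℝ → E3 → E3) (p : ℝ → E3 → ℝ), 0 < T → IsSolutionOn (Ico 0 T) ν u₀ u p →
        (∫⁻ t in Ioo 0 T, ⨆ x : E3, ‖fderiv ℝ (u t) x‖ₑ) < ⊤) →
    clayPeriodicErrata.Solvable ν 0 u₀

/-- **Thm 7.9 p.19, direction (i) ⇒ (ii)** (the one Prop 6.5 uses, via Cor 7.8): bounded entropy and
finite `∫∫|∇E|²` on `[0,T)` imply `∫₀ᵀ‖∇u‖_∞ < ∞`. [cite: Betts2026, Thm 7.9 (i)⇒(ii) (111) p.19 l.3–32] [claim: Betts2026, status: under-review] -/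
def Step_Thm79 : Prop :=
  ∀ ν : ℝ, 0 < ν → ∀ u₀ : E3 → E3, IsDatum u₀ →
    ∀ (T : ℝ) (u : ℝ → E3 → E3) (p : ℝ → E3 → ℝ) (Φ : ℝ → E3 → E3), 0 < T →
      IsSolutionOn (Ico 0 T) ν u₀ u p → IsFlowMap T u Φ →
        (∃ M : ℝ, ∀ t ∈ Ico 0 T, entropy Φ t ≤ M) →
        (∫⁻ t in Ioo 0 T, ENNReal.ofReal (gradESq Φ t)) < ⊤ →
          (∫⁻ t in Ioo 0 T, ⨆ x : E3, ‖fderiv ℝ (u t) x‖ₑ) < ⊤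

/-! ## API for the definitions: `E = 0` at the identity deformation (Remark 3.7 p.7) -/

/-- The spectral logarithm of the identity vanishes: every eigenvalue of `1` is `1` and `log 1 = 0`
(Remark 3.7 p.7 «E = 0 when U = I»). [cite: Betts2026, Remark 3.7 p.7 l.48–52] -/
theorem symLog_of_eq_one {A : Op} (hA : (A : E3 →ₗ[ℝ] E3).IsSymmetric) (h1 : A = 1) :
    symLog A hA = 0 := by
  subst h1
  have hev : ∀ (q : Module.finrank ℝ E3 = 3) (i : Fin 3), hA.eigenvalues q i = 1 := by
    intro q i
    have h := hA.apply_eigenvectorBasis q i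
    have hb : (hA.eigenvectorBasis q i : E3) ≠ 0 := (hA.eigenvectorBasis q).orthonormal.ne_zero i
    simp only [ContinuousLinearMap.toLinearMap_one, Module.End.one_apply] at h
    have h2 : ((1 : ℝ) - hA.eigenvalues q i) • (hA.eigenvectorBasis q i : E3) = 0 := by
      rw [sub_smul, one_smul, sub_eq_zero]
      exact_mod_cast h
    rcases smul_eq_zero.1 h2 with h3 | h3
    · linarith
    · exact absurd h3 hb
  unfold symLog
  refine Finset.sum_eq_zero fun i _ => ?_
  rw [hev, Real.log_one, zero_smul]

/-- `E = log U = 0` at the identity deformation `F = I` (Remark 3.7 p.7). [cite: Betts2026, Remark 3.7 p.7 l.48–52] -/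
theorem logStrain_one : logStrain (1 : Op) = 0 := by
  have h1 : cauchyGreen (1 : Op) = 1 := by simp [cauchyGreen]
  unfold logStrain
  rw [symLog_of_eq_one (isSymmetric_cauchyGreen 1) h1]
  exact smul_zero ((1 : ℝ) / 2 : ℝ) (A := Op)

/-- `|0|² = 0` (Remark 3.7 p.7: «E = 0 … 𝓔(t) = 0»). [cite: Betts2026, Remark 3.7 p.7 l.48–52] -/
theorem frobSq_zero : frobSq (0 : Op) = 0 := by
  simp [frobSq, frob]

/-- At `t = 0` a flow map is the identity, so `F(·,0) = I` ((14) p.4 «Φ₀(a) = a»).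
[cite: Betts2026, (14) p.4] -/
theorem defGrad_zero {T : ℝ} {u : ℝ → E3 → E3} {Φ : ℝ → E3 → E3} (hΦ : IsFlowMap T u Φ) (a : E3) :
    defGrad Φ 0 a = 1 := by
  have h0 : Φ 0 = id := funext hΦ.1
  rw [defGrad, h0, fderiv_id]
  rfl

/-- **`𝓔(0) = 0` for every flow** (Remark 3.7 p.7 «E = 0 when U = I (no deformation), 𝓔(t) = 0
corresponds to the trivial flow»; at `t = 0`, `Φ₀ = id`, `F = I`, `E = 0`). [cite: Betts2026, Remark 3.7 p.7 l.48–52; (14) p.4] -/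
theorem entropy_zero {T : ℝ} {u : ℝ → E3 → E3} {Φ : ℝ → E3 → E3} (hΦ : IsFlowMap T u Φ) :
    entropy Φ 0 = 0 := by
  unfold entropy torusIntegral
  simp_rw [defGrad_zero hΦ, logStrain_one, frobSq_zero]
  exact integral_zero _ _

/-! ## What IS a theorem: Thm 5.4 (trace cyclicity) -/

/-- **Thm 5.4 HOLDS (PROVED)**: `E : [E,Ω] = tr(Eᵀ(EΩ − ΩE)) = tr(E²Ω) − tr(EΩE) = 0` for symmetric
`E` (trace cyclicity (62)–(64) p.12; the skew-symmetry of `Ω` is not even needed).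
[cite: Betts2026, Thm 5.4 (62)–(64) p.12] -/
theorem step_Thm54_holds : Step_Thm54 := by
  intro E Ω hE _hΩ
  unfold frob comm
  rw [hE, mul_sub, ContinuousLinearMap.toLinearMap_sub, map_sub, sub_eq_zero]
  simp only [ContinuousLinearMap.toLinearMap_mul]
  rw [← mul_assoc, LinearMap.trace_mul_comm ℝ ((E : E3 →ₗ[ℝ] E3) * (E : E3 →ₗ[ℝ] E3)),
    LinearMap.trace_mul_comm ℝ (E : E3 →ₗ[ℝ] E3), mul_assoc]

/-! ## Compositions (PROVED) -/

/-- `√x ≤ 1 + x` in `ℝ≥0∞` form for `ofReal`: `ofReal (√r) ≤ 1 + ofReal r`. (Proof device replacing the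
print's (94), which bounds `∫‖∇E‖_{L²}` by `∫‖∇E‖²_{L²}`.) [folklore] -/
private theorem ofReal_sqrt_le (r : ℝ) : ENNReal.ofReal (Real.sqrt r) ≤ 1 + ENNReal.ofReal r := by
  rcases le_or_gt r 0 with hr | hr
  · rw [Real.sqrt_eq_zero'.2 hr]; simp
  · have h : Real.sqrt r ≤ 1 + r :=
      calc Real.sqrt r ≤ Real.sqrt ((1 + r) ^ 2) := Real.sqrt_le_sqrt (by nlinarith)
        _ = 1 + r := Real.sqrt_sq (by linarith)
    calc ENNReal.ofReal (Real.sqrt r) ≤ ENNReal.ofReal (1 + r) := ENNReal.ofReal_le_ofReal h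
      _ = 1 + ENNReal.ofReal r := by rw [ENNReal.ofReal_add zero_le_one hr.le, ENNReal.ofReal_one]

/-- **Prop 6.5 from Thm 6.3 + Cor 5.13 + Cor 5.14 (the arithmetic (89)–(96) p.16, PROVED)**:
`∫₀ᵀ ⨆‖∇u‖ ≤ C(∫₀ᵀ √𝓔 + ∫₀ᵀ ‖∇E‖₂) ≤ C(T√𝓔(0) + T + C'𝓔(0)) < ∞`. [cite: Betts2026, Prop 6.5 (89)–(96) p.16] -/
theorem prop65_of_steps (h63 : Step_Thm63) (h513 : Step_Cor513) (h514 : Step_Cor514) :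
    Step_Prop65 := by
  obtain ⟨C, hC⟩ := h63
  intro ν hν u₀ hd T u p Φ hT hsol hΦ
  obtain ⟨C', hC'⟩ := h514 ν hν
  have h1 : ∀ t ∈ Ioo 0 T, (⨆ x : E3, ‖fderiv ℝ (u t) x‖ₑ) ≤
      C * (ENNReal.ofReal (normE Φ 0) + (1 + ENNReal.ofReal (gradESq Φ t))) := by
    intro t ht
    refine (hC ν hν u₀ hd T u p Φ hT hsol hΦ t ⟨ht.1.le, ht.2⟩).trans ?_
    refine mul_le_mul_right (add_le_add ?_ (ofReal_sqrt_le _)) _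
    exact ENNReal.ofReal_le_ofReal
      (Real.sqrt_le_sqrt (h513 ν hν u₀ hd T u p Φ hT hsol hΦ t ⟨ht.1.le, ht.2⟩))
  have h2 : (∫⁻ t in Ioo 0 T, ⨆ x : E3, ‖fderiv ℝ (u t) x‖ₑ) ≤
      ∫⁻ t in Ioo 0 T, C * (ENNReal.ofReal (normE Φ 0) + (1 + ENNReal.ofReal (gradESq Φ t))) :=
    setLIntegral_mono' measurableSet_Ioo h1
  refine lt_of_le_of_lt h2 ?_
  rw [lintegral_const_mul' _ _ ENNReal.coe_ne_top, lintegral_add_left measurable_const,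
    lintegral_add_left measurable_const, setLIntegral_const, setLIntegral_const, Real.volume_Ioo]
  refine ENNReal.mul_lt_top ENNReal.coe_lt_top ?_
  refine ENNReal.add_lt_top.2 ⟨ENNReal.mul_lt_top ENNReal.ofReal_lt_top ENNReal.ofReal_lt_top,
    ENNReal.add_lt_top.2 ⟨ENNReal.mul_lt_top ENNReal.one_lt_top ENNReal.ofReal_lt_top, ?_⟩⟩
  exact lt_of_le_of_lt (hC' u₀ hd T u p Φ hT hsol hΦ)
    (ENNReal.mul_lt_top ENNReal.coe_lt_top ENNReal.ofReal_lt_top)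

/-- **COMPOSITION (PROVED)** — the printed route to Thm 1.1 (§6 with §9): flow maps exist, Thm 6.3 +
Cor 5.13 + Cor 5.14 give `∫₀ᵀ‖∇u‖_∞ < ∞` on every slab (Prop 6.5), and BKM-continuation with local
existence (Thm 6.1 + §9) gives the global smooth periodic solution. [cite: Betts2026, §6 p.15–16; §9 p.21–23] -/
theorem claim_of_steps (hΦ : Step_FlowMap) (h63 : Step_Thm63) (h513 : Step_Cor513)
    (h514 : Step_Cor514) (hBKM : Step_Thm61_BKM) : ClaimedTheorem := by
  intro ν hν u₀ hd
  refine hBKM ν hν u₀ hd fun T u p hT hsol => ?_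
  obtain ⟨Φ, hflow⟩ := hΦ ν hν u₀ hd T u p hT hsol
  exact prop65_of_steps h63 h513 h514 ν hν u₀ hd T u p Φ hT hsol hflow

/-- **COMPOSITION to Clay (B) (PROVED)**. [cite: Betts2026, Thm 1.1 p.3] [cite: FeffermanClay2006, (B) p.2] -/
theorem clayB_of_steps (hΦ : Step_FlowMap) (h63 : Step_Thm63) (h513 : Step_Cor513)
    (h514 : Step_Cor514) (hBKM : Step_Thm61_BKM) : clayPeriodic.Regularity :=
  clayB_of_claimed (claim_of_steps hΦ h63 h513 h514 hBKM)

/-! ## Rev 2 (append-only): `∇E(·,0) = 0` — the label-gradient of the logarithmic strain vanishes at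
`t = 0` for every flow map (Remark 3.7 p.7 / (127) p.22: `F(·,0) = I`, `E(·,0) = 0` identically), so
`‖∇E(0)‖_{L²} = 0` alongside `𝓔(0) = 0` (`entropy_zero`). API for the definitions; nothing asserted. -/

/-- At `t = 0` the logarithmic strain field `a ↦ E(a,0)` is identically `0`, hence so is its label
derivative. [cite: Betts2026, Remark 3.7 p.7 l.48–52; (127) p.22] -/
theorem fderiv_logStrain_zero {T : ℝ} {u : ℝ → E3 → E3} {Φ : ℝ → E3 → E3} (hΦ : IsFlowMap T u Φ)
    (a : E3) : fderiv ℝ (fun b => logStrain (defGrad Φ 0 b)) a = 0 := by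
  have h : (fun b => logStrain (defGrad Φ 0 b)) = fun _ => (0 : Op) := by
    funext b; rw [defGrad_zero hΦ, logStrain_one]
  rw [h]
  exact fderiv_const_apply (0 : Op)

/-- **`‖∇E(0)‖²_{L²} = 0` for every flow** (Remark 3.7 p.7; (127) p.22 «E(0) is determined by u₀ via the
initial deformation gradient F(0) = I»). [cite: Betts2026, Remark 3.7 p.7 l.48–52; (127) p.22] -/
theorem gradESq_zero {T : ℝ} {u : ℝ → E3 → E3} {Φ : ℝ → E3 → E3} (hΦ : IsFlowMap T u Φ) :
    gradESq Φ 0 = 0 := by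
  unfold gradESq torusIntegral
  have h : ∀ a : E3, ‖fderiv ℝ (fun b => logStrain (defGrad Φ 0 b)) a‖ ^ 2 = 0 := fun a => by
    rw [fderiv_logStrain_zero hΦ a, ContinuousLinearMap.opNorm_zero]; norm_num
  simp_rw [h]
  exact integral_zero _ _

/-- `‖E(0)‖_{L²} = 0` for every flow (from `entropy_zero`). [cite: Betts2026, Remark 3.7 p.7 l.48–52] -/
theorem normE_zero {T : ℝ} {u : ℝ → E3 → E3} {Φ : ℝ → E3 → E3} (hΦ : IsFlowMap T u Φ) :
    normE Φ 0 = 0 := by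
  rw [normE, entropy_zero hΦ, Real.sqrt_zero]

/-! ## Rev 3 (append-only): injectivity of the spectral logarithm — `E = 0 ⇒ FᵀF = I`

API for the definitions (2-READ typist-2 g6 11:21:05Z (6): the `symLog = 0 ⇒ C = 1`-type lemma the
(83) face needs); nothing asserted, no Step added. -/

/-- The spectral logarithm acts diagonally on the eigenbasis: `(log A) bⱼ = log(λⱼ) bⱼ` (Def 3.1 (25) p.6).
[cite: Betts2026, Def 3.1 (24)–(25) p.6] -/
theorem symLog_apply_eigenvectorBasis (A : Op) (hA : (A : E3 →ₗ[ℝ] E3).IsSymmetric) (j : Fin 3) :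
    symLog A hA (hA.eigenvectorBasis finrank_euclideanSpace_fin j) =
      Real.log (hA.eigenvalues finrank_euclideanSpace_fin j) •
        (hA.eigenvectorBasis finrank_euclideanSpace_fin j : E3) := by
  unfold symLog
  have hon := orthonormal_iff_ite.mp (hA.eigenvectorBasis finrank_euclideanSpace_fin).orthonormal
  simp only [FunLike.coe_sum, Finset.sum_apply, FunLike.coe_smul,
    Pi.smul_apply, ContinuousLinearMap.smulRight_apply, innerSL_apply_apply, hon, ite_smul, one_smul,
    zero_smul, smul_ite, smul_zero]
  rw [Finset.sum_ite_eq' Finset.univ j]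
  simp

/-- **`log A = 0` forces `A = I`** for a symmetric operator with positive eigenvalues (Def 3.1 p.6 with
Remark 3.7 p.7 «E = 0 when U = I»: the converse direction, `E = 0 ⇒ U = I`). [cite: Betts2026, Def 3.1 p.6; Remark 3.7 p.7 l.48–52] -/
theorem eq_one_of_symLog_eq_zero (A : Op) (hA : (A : E3 →ₗ[ℝ] E3).IsSymmetric)
    (hpos : ∀ i, 0 < hA.eigenvalues finrank_euclideanSpace_fin i) (h0 : symLog A hA = 0) :
    A = 1 := by
  set b := hA.eigenvectorBasis finrank_euclideanSpace_fin with hb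
  have hev : ∀ j, hA.eigenvalues finrank_euclideanSpace_fin j = 1 := by
    intro j
    have h := symLog_apply_eigenvectorBasis A hA j
    rw [h0] at h; simp only [zero_apply] at h

    have hbj : (b j : E3) ≠ 0 := b.orthonormal.ne_zero j
    rcases smul_eq_zero.1 h.symm with h1 | h1
    · exact Real.eq_one_of_pos_of_log_eq_zero (hpos j) h1
    · exact absurd h1 hbj
  -- A agrees with 1 on the basis
  refine ContinuousLinearMap.coe_injective (b.toBasis.ext fun j => ?_)
  have h := hA.apply_eigenvectorBasis finrank_euclideanSpace_fin j
  rw [hev] at h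
  simpa [hb] using h

/-- The eigenvalues of `C = FᵀF` are positive when `F` is injective: `λⱼ = ⟪C bⱼ, bⱼ⟫ = ‖F bⱼ‖² > 0`
(§4.1 p.8 «C … symmetric positive-definite»; Thm 2.5 p.5). [cite: Betts2026, §4.1 p.8 l.58–66; Thm 2.5 p.5] -/
theorem eigenvalues_cauchyGreen_pos (F : Op) (hF : ∀ x : E3, F x = 0 → x = 0) (i : Fin 3) :
    0 < (isSymmetric_cauchyGreen F).eigenvalues finrank_euclideanSpace_fin i := by
  set hA := isSymmetric_cauchyGreen F
  set b := hA.eigenvectorBasis finrank_euclideanSpace_fin with hb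
  have h := hA.apply_eigenvectorBasis finrank_euclideanSpace_fin i
  have hb1 : ‖(b i : E3)‖ = 1 := b.orthonormal.1 i
  have hne : F (b i) ≠ 0 := fun h0 => b.orthonormal.ne_zero i (hF _ h0)
  have hinner : ⟪(cauchyGreen F) (b i), (b i : E3)⟫_ℝ = ‖F (b i)‖ ^ 2 := by
    change ⟪(star F) (F (b i)), (b i : E3)⟫_ℝ = _
    rw [ContinuousLinearMap.star_eq_adjoint, ContinuousLinearMap.adjoint_inner_left,
      real_inner_self_eq_norm_sq]
  have h2 : ⟪(cauchyGreen F) (b i), (b i : E3)⟫_ℝ =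
      hA.eigenvalues finrank_euclideanSpace_fin i := by
    have h' : (cauchyGreen F) (b i) = (hA.eigenvalues finrank_euclideanSpace_fin i : ℝ) • (b i : E3) := by
      exact_mod_cast h
    rw [h', real_inner_smul_left, real_inner_self_eq_norm_sq, hb1]; ring
  have hpos : 0 < ‖F (b i)‖ ^ 2 := by positivity
  linarith [hinner.symm.trans h2]

/-- **`E = 0 ⇒ C = FᵀF = I`** for an injective deformation gradient (Remark 3.7 p.7: the logarithmic
strain vanishes exactly at the undeformed state `U = I`; with (83) «𝓔(t) ≤ 𝓔(0)» and `entropy_zero` this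
is the content the lanes read off Cor 5.13). [cite: Betts2026, Remark 3.7 p.7 l.48–52; Def 3.1 p.6] -/
theorem cauchyGreen_eq_one_of_logStrain_eq_zero (F : Op) (hF : ∀ x : E3, F x = 0 → x = 0)
    (h : logStrain F = 0) : cauchyGreen F = 1 := by
  have h2 : symLog (cauchyGreen F) (isSymmetric_cauchyGreen F) = 0 := by
    have h' := congrArg (fun A : Op => (2 : ℝ) • A) h
    simp only [logStrain, smul_smul] at h'
    norm_num at h'
    have hz : (2 : ℝ) • (0 : Op) = 0 := by ext x; simp
    rw [hz] at h'
    exact h'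
  exact eq_one_of_symLog_eq_zero _ _ (eigenvalues_cauchyGreen_pos F hF) h2


/-! ## Discharge of `Step_FlowMap` (TRUE column; D-0026 debt −1; append-only, typist-2 g6) -/

/-- **`Step_FlowMap` HOLDS** (the printed «flow map well-posedness», Prop 2.3 p.5, for smooth periodic
classical solutions on `[0,T)`): the velocity of an `IsSolutionOn (Ico 0 T)` solution is jointly smooth on
`[0,T) × ℝ³` (`IsClassicalNSSolutionOn.smooth_velocity`) with `ℤ³`-periodic slices, hence bounded and
uniformly Lipschitz on every `[0,T'] × ℝ³`, `T' < T`, so the particle-trajectory map `Φ₀ = id`,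
`∂ₜΦ_t(x) = u(Φ_t(x), t)` exists on the whole slab (tool
`Literature.Analysis.ODE.exists_flow_Ico_of_isSmoothSpaceTimeOn_periodic`: Hartman's Thm. II.1.1 on the
closed slabs `[0,T']`, patched by uniqueness). [cite: Betts2026, (12)–(14) p.4; Prop 2.3 p.5]
[cite: Hartman2002, Ch. II Thm. 1.1 (PDF pp. 18–19)] -/
theorem step_FlowMap_holds : Step_FlowMap := by
  intro _ _ _ _ T u _ _ hsol
  obtain ⟨Φ, h0, hΦ⟩ := Literature.Analysis.ODE.exists_flow_Ico_of_isSmoothSpaceTimeOn_periodic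
    hsol.solves.smooth_velocity (fun t ht => (hsol.periodic t ht).1)
  exact ⟨Φ, h0, hΦ⟩

/-- `Step_FlowMap` — `_holds` alias of `step_FlowMap_holds` above under the fact's exact name (appended
2026-08-28, D-0026 bookkeeping: the proof term is the existing theorem of this file; no statement,
definition or attribute is edited; no new named fact; the ledger's debt table listed the fact
unproved). [cite: Hartman2002, Ch. II Thm. 1.1 (PDF pp. 18–19)] -/
theorem _root_.Literature.Claims.NS.Betts2026.Step_FlowMap_holds : Step_FlowMap :=
  _root_.Literature.Claims.NS.Betts2026.step_FlowMap_holds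


/-! ## Rev 5 (ADDITIVE — nothing above is touched): Step `Step_Thm61_BKM` is a theorem; the chain with
both TRUE-type binders (`Step_FlowMap`, `Step_Thm61_BKM`) discharged -/

section BKM

open Literature.Barriers.NavierStokesRegularity (continuousOn_iSup_norm_fderiv' norm_fderiv_le_iSup)

/-- **Step `Step_Thm61_BKM` (Thm 6.1 (87) p.15 with the §9 assembly: the periodic Beale–Kato–Majda
criterion in the integral-GRADIENT form) IS A THEOREM of the tree.** If every classical `u`,`p`-periodic
solution on every slab `[0,T)` from the datum has `∫₀ᵀ sup_x ‖∇u‖ < ∞`, the datum is solvable in the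
errata class (10): by the tree's periodic blow-up alternative (`clayPeriodic_solvable_or_gradientSupBlowup`,
Robinson–Rodrigo–Sadowski §6.3/§8.1: a maximal torus solution whose enstrophy is unbounded in the
blow-up branch), the descent `torus_descend_of_periodic`, and the enstrophy bound under a continuous
vorticity majorant `Torus.gradNormSq_le_mul_exp_integral_vorticityBound` (RRS (12.11)–(12.12)) fed with
`M(t) = 3·sup_x ‖∇U(t, x)‖` (continuous in `t`, `continuousOn_iSup_norm_fderiv'`; `|ω|² ≤ 2Σᵢ‖∂ᵢU‖² ≤ 6 sup²`;
`∫₀ᵗ M ≤ 3·(∫⁻₀^{T*} sup‖∇u‖ₑ).toReal`), the enstrophy stays bounded on `[0,T*)` — contradiction; the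
printed class (10) and the errata class have the same solvable problems (`clayPeriodic_solvable_zero_iff_errata`).
[cite: Betts2026, Thm 6.1 (87) p.15 l.30–35; §9 p.21–23] [cite: BealeKatoMajda1984, Thm 1]
Literature-side twin of the salvage lane's `Summit.NavierStokesRegularity.NavierStokesRegularity.Theorems.Betts2026Salvage.step_Thm61_BKM_holds`
(`Theorems/SoloSalvageBetts2026.lean`, ns-claims-salvage-p1 g3, p529193 — same statement, independent proof; a
Literature file cannot import the Summits tree, so the discharge is re-proved here next to the `def`).
[cite: RobinsonRodrigoSadowskiCUP2016, Thm 12.3 with (12.11)–(12.12); §6.3, §8.1] -/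
theorem step_Thm61_BKM_holds : Step_Thm61_BKM := by
  intro ν hν u₀ hd H
  rw [← clayPeriodic_solvable_zero_iff_errata]
  rcases clayPeriodic_solvable_or_gradientSupBlowup hν hd.smooth hd.divFree hd.periodic with
    hsol | ⟨Ts, hTs, u, p, hcl, hu0, hperT, -, hens, -⟩
  · exact hsol
  exfalso
  -- the printed hypothesis on this solution: `∫₀^{T*} sup |∇u| < ∞`
  have hfin := H Ts u p hTs ⟨hcl, hu0, hperT⟩
  -- descend to the torus
  obtain ⟨hU, hUlift⟩ := torus_descend_of_periodic hcl hperT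
  set U : ℝ → UnitAddTorus (Fin 3) → E3 := fun t x => u t (Torus.repr x) with hUdef
  -- the gradient sup of the torus slices
  set m : ℝ → ℝ := fun t => ⨆ x, ‖FunctionSpaces.Torus.fderiv (U t) x‖ with hm
  have hmc : ContinuousOn m (Ico 0 Ts) :=
    continuousOn_iSup_norm_fderiv' (uniqueDiffOn_Ico 0 Ts) hU.smooth_velocity
  have hm0 : ∀ t, 0 ≤ m t := fun t => Real.iSup_nonneg fun x => norm_nonneg _
  -- pointwise in time: the torus gradient sup is below the `ℝ³` gradient sup of the printed hypothesis
  have hR : ∀ s ∈ Ico 0 Ts, ENNReal.ofReal (m s) ≤ ⨆ x : E3, ‖fderiv ℝ (u s) x‖ₑ := by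
    intro s hs
    set R : ℝ≥0∞ := ⨆ x : E3, ‖fderiv ℝ (u s) x‖ₑ with hRdef
    rcases eq_or_ne R ⊤ with htop | hne
    · rw [htop]; exact le_top
    have hle : ∀ y, ‖FunctionSpaces.Torus.fderiv (U s) y‖ ≤ R.toReal := by
      intro y
      have h1 : FunctionSpaces.Torus.fderiv (U s) y = fderiv ℝ (u s) (Torus.repr y) := by
        have h := FunctionSpaces.Torus.fderiv_lift (U s) (Torus.repr y)
        rw [FunctionSpaces.Torus.proj_repr, hUlift s hs] at h
        exact h.symm
      rw [h1]
      have h2 : ‖fderiv ℝ (u s) (Torus.repr y)‖ₑ ≤ R :=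
        le_iSup (fun x : E3 => ‖fderiv ℝ (u s) x‖ₑ) (Torus.repr y)
      have h3 := ENNReal.toReal_mono hne h2
      simpa using h3
    have hms : m s ≤ R.toReal := ciSup_le hle
    calc ENNReal.ofReal (m s) ≤ ENNReal.ofReal R.toReal := ENNReal.ofReal_le_ofReal hms
      _ = R := ENNReal.ofReal_toReal hne
  -- the time integral of the torus gradient sup is bounded by the printed (finite) integral
  set L : ℝ≥0∞ := ∫⁻ s in Ioo 0 Ts, ⨆ x : E3, ‖fderiv ℝ (u s) x‖ₑ with hLdef
  have hLt : L < ⊤ := hfin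
  have hint : ∀ t ∈ Ico 0 Ts, ∫ s in (0 : ℝ)..t, m s ≤ L.toReal := by
    intro t ht
    have hcont : ContinuousOn m (Icc 0 t) := hmc.mono (Icc_subset_Ico_right ht.2)
    rw [intervalIntegral.integral_of_le ht.1]
    have hI : IntegrableOn m (Ioc 0 t) :=
      (hcont.integrableOn_compact isCompact_Icc).mono_set Ioc_subset_Icc_self
    have h1 : ENNReal.ofReal (∫ s in Ioc 0 t, m s) = ∫⁻ s in Ioc 0 t, ENNReal.ofReal (m s) :=
      ofReal_integral_eq_lintegral_ofReal hI (ae_of_all _ fun s => hm0 s)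
    have h2 : (∫⁻ s in Ioc 0 t, ENNReal.ofReal (m s)) ≤ L :=
      calc (∫⁻ s in Ioc 0 t, ENNReal.ofReal (m s)) ≤ ∫⁻ s in Ioc 0 t, ⨆ x : E3, ‖fderiv ℝ (u s) x‖ₑ :=
            setLIntegral_mono' measurableSet_Ioc fun s hs => hR s ⟨hs.1.le, lt_of_le_of_lt hs.2 ht.2⟩
        _ ≤ L := lintegral_mono_set (Ioc_subset_Ioo_right ht.2)
    rw [← h1] at h2
    exact (ENNReal.ofReal_le_iff_le_toReal hLt.ne).1 h2
  -- pointwise vorticity majorant `|ω(t,x)|² ≤ (3 m(t))²`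
  have hω : ∀ t ∈ Ico 0 Ts, ∀ x, torusVorticitySqAt (U t) x ≤ (3 * m t) ^ 2 := by
    intro t ht x
    have hsm : FunctionSpaces.Torus.IsSmooth (U t) := hU.smooth_velocity.isSmooth_slice ht
    have h1 : FunctionSpaces.Torus.IsContDiff 1 (U t) := hsm.isContDiff (n := 1) (by exact_mod_cast le_top)
    have hpd : ∀ i, ‖FunctionSpaces.Torus.partialDeriv i (U t) x‖ ≤ m t := by
      intro i
      rw [FunctionSpaces.Torus.partialDeriv_eq_fderiv_apply h1]
      refine (ContinuousLinearMap.le_opNorm _ _).trans ?_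
      have hn : ‖(EuclideanSpace.single i (1 : ℝ) : EuclideanSpace ℝ (Fin 3))‖ = 1 := by simp
      rw [hn, mul_one]
      exact norm_fderiv_le_iSup hsm x
    calc torusVorticitySqAt (U t) x ≤ 2 * ∑ i, ‖FunctionSpaces.Torus.partialDeriv i (U t) x‖ ^ 2 :=
          torusVorticitySqAt_le_two_mul_sum_norm_sq _ _
      _ ≤ 2 * ∑ _i : Fin 3, m t ^ 2 := by
          refine mul_le_mul_of_nonneg_left (Finset.sum_le_sum fun i _ => ?_) (by norm_num)
          exact pow_le_pow_left₀ (norm_nonneg _) (hpd i) 2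
      _ = 6 * m t ^ 2 := by simp; ring
      _ ≤ (3 * m t) ^ 2 := by nlinarith [sq_nonneg (m t)]
  have hMc : ContinuousOn (fun t => 3 * m t) (Ico 0 Ts) := continuousOn_const.mul hmc
  have hM0 : ∀ t ∈ Ico 0 Ts, 0 ≤ 3 * m t := fun t _ => by have := hm0 t; positivity
  -- the enstrophy stays bounded on `[0, T*)` — contradiction with the blow-up branch
  apply hens
  refine ⟨FunctionSpaces.Torus.gradNormSq (U 0) * Real.exp (2 * (3 * L.toReal)), ?_⟩
  rintro _ ⟨t, ht, rfl⟩
  have h := Torus.gradNormSq_le_mul_exp_integral_vorticityBound (d := Fin 3) (by simp) hν.le hU hMc hM0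
    hω ht
  refine h.trans (mul_le_mul_of_nonneg_left (Real.exp_le_exp.2 ?_)
    (FunctionSpaces.Torus.gradNormSq_nonneg _))
  rw [intervalIntegral.integral_const_mul]
  nlinarith [hint t ht]

end BKM

/-- The claimed theorem from the three printed steps Thm 6.3, Cor 5.13, Cor 5.14 alone (the flow map
and the BKM assembly being theorems: `step_FlowMap_holds`, `step_Thm61_BKM_holds`).
[cite: Betts2026, Prop 6.5 p.16; §9 p.21–23] -/
theorem claim_of_steps' (h63 : Step_Thm63) (h513 : Step_Cor513) (h514 : Step_Cor514) : ClaimedTheorem :=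
  claim_of_steps step_FlowMap_holds h63 h513 h514 step_Thm61_BKM_holds

/-- Clay (B) from the three printed steps Thm 6.3, Cor 5.13, Cor 5.14 alone.
[cite: Betts2026, Prop 6.5 p.16; §9 p.21–23] [cite: FeffermanClay2006, (B) p. 2] -/
theorem clayB_of_steps' (h63 : Step_Thm63) (h513 : Step_Cor513) (h514 : Step_Cor514) :
    clayPeriodic.Regularity :=
  clayB_of_claimed (claim_of_steps' h63 h513 h514)

end

end Literature.Claims.NS.Betts2026
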